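import Mathlib
import HarnessLib
import Literature.Combinatorics.Additive.Kneser

/-!
# Noncommutative sets of small doubling: the Hamidoune–Tao weak Kneser theorem
# (Tao 2013, Theorem 2, with Lemma 3, Proposition 4 and Corollary 1)

Topic `Literature/Combinatorics/Additive`.  Cell `mm-stpp` (D-0046), seat `mm-stpp-lit` (gen 12);
companion of `Kneser.lean` (Kneser's theorem for abelian groups, used here only for Corollary 1)
and of `OlsonSumsInGroups.lean` (Olson's non-abelian substitutes for Kneser).  Everything in this
file is PROVED (no named facts), for an ARBITRARY group `G` written multiplicatively.

T. Tao, *Noncommutative sets of small doubling*, European J. Combin. 34 (2013) 1459–1465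
(arXiv:1106.2267):

**Corollary 1 (of Kneser's theorem; abelian).**  "Let `A` be a finite non-empty subset of an
additive group `G` such that `|A + A| ≤ (2 − ε)|A|` for some `ε > 0`.  Then there exists a finite
group `H` with `|H| ≤ (2 − ε)|A|`, such that `A + A` is covered by at most `2/ε − 1` translates of
`H`." — `kneser_small_doubling` (commutative groups, multiplicative notation; `H` = the stabilizer
`(A * A).mulStab` of `Kneser.lean`, `ε|A| ≤ |H| ≤ (2 − ε)|A|`, and `A·A = X·H` with
`|X| ≤ 2/ε − 1`), from the tree's `card_add_card_le_card_mul_add_card_mulStab` (Kneser).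

**Lemma 3 (Submodularity).**  With `c(A) = c_{K,S}(A) := |A·S| − K|A|`: "For any finite subsets
`A, B, S` of `G`, and any `K ∈ ℝ` one has `c(A ∪ B) + c(A ∩ B) ≤ c(A) + c(B)`." —
`HamidouneTao.submodularity`; left-invariance (3) `c(x·A) = c(A)` — `HamidouneTao.conn_singleton_mul`;
(5) `c(A) ≥ (1 − K)|A|` for `K < 1` — `HamidouneTao.sub_mul_card_le_conn`.  Throughout, `c` is
passed as a function together with the hypothesis `∀ A, c A = #(A * S) − K * #A` (no definition is
introduced).

**§2 (fragments and atoms; Hamidoune).**  Existence of an atom for `K < 1` ("`c(A)` is always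
positive … at least one fragment exists, which … implies that at least one atom exists") —
`HamidouneTao.exists_atom` (a fragment = minimiser of `c` over non-empty finite sets; an atom = a
fragment of least cardinality; the kernel proof runs the minimisation over the finitely many pairs
`(|B|, |B·S|)` with `|B| ≤ M`, since `c(B) ≥ (1 − K)|B|` exceeds `c({1})` beyond `M`);
"`A ∪ B` and `A ∩ B` are also fragments" — `HamidouneTao.fragment_inter_union`; "any two atoms
are either equal or disjoint" — `HamidouneTao.atom_eq_of_inter_nonempty`.

**Proposition 4.**  "Let `K < 1`.  Then there exists a finite group `H`, such that every left-coset
of `H` is an atom." — `HamidouneTao.exists_atom_subgroup` (the atom `H ∋ 1` is a finite set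
containing `1`, closed under `*` and `⁻¹`, and is an atom; "this atom is either equal or disjoint to
any of its left-translates, which implies that `H` is a finite group").

**Theorem 2 (Weak Kneser-type theorem; Hamidoune–Tao).**  "Let `A, S` be finite non-empty subsets
of a multiplicative group `G` such that `|A| ≥ |S|` and `|A·S| ≤ (2 − ε)|S|` for some `ε > 0`.
Then one of the following statements hold: • `S` is contained in a right-coset of a finite group
`H` with `|H| ≤ (2/ε)|S|`; • `S` is covered by at most `2/ε − 1` right cosets of a finite group `H`
with `|H| ≤ |S|`." — `HamidouneTao.weak_kneser` (`H` as a finite subset closed under `*`, `⁻¹`,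
`1 ∈ H`; the cover as `S ⊆ H * X` with `X ⊆ S`, `|X| ≤ 2/ε − 1`) and `HamidouneTao.weak_kneser_subgroup`
(`H : Subgroup G`, `Nat.card H`).  Proof as printed (§3: `K = 1 − ε/2`, `c(H) ≤ c(A) ≤ (1 − ε/2)|S|`,
`c(H) ≥ (ε/2)|H|`; if `S` meets two right cosets then `|H·S| ≥ 2|H|` and (hs)); the count of cosets
uses a minimal system of representatives `X ⊆ S` with `|H||X| ≤ |H·S|`
(`exists_repr_rightCosets`, private).  The first bullet is obtained with the printed proof's
sharper constant `|H| ≤ (2/ε − 1)|S| ≤ (2/ε)|S|`.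

NOT FORMALIZED: Remark 5, §4 (the connections with Sanders' and Petridis' results).  This is the
theorem quoted as "Theorem 1.9 (Hamidoune, Tao)" in DeVos, *The structure of critical product sets*
(arXiv:1301.0096), listed in the cell's LIT-INDEX §11 (f) as print-only.  Census-silent for the
cell `mm-stpp`.

## References
* T. Tao, *Noncommutative sets of small doubling*, European J. Combin. 34 (2013) 1459–1465,
  arXiv:1106.2267 — held `paper:arxiv-1106.2267`, chunks p0001–p0005 (abstract, §1 Cor 1 and Thm 2,
  §2 Lemma 3 / fragments / atoms / Prop 4, §3 proof of Thm 2) read in full 2026-08-28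
  [cite: Tao2013SmallDoubling, Cor 1; Lemma 3; Prop 4; Thm 2].
* Y. O. Hamidoune's isoperimetric method (atoms and fragments), as credited there ([hamidoune],
  [ham1]–[hls]); M. DeVos, arXiv:1301.0096, Thm 1.9 (attribution "Hamidoune, Tao").
* M. Kneser (1953) / the tree's `Literature/Combinatorics/Additive/Kneser.lean`
  (`card_add_card_le_card_mul_add_card_mulStab`, `Finset.mulStab`) for Corollary 1.
-/

namespace Literature.Combinatorics.Additive

open Finset
open scoped Pointwise

variable {G : Type*} [Group G] [DecidableEq G]

namespace HamidouneTao

/-! ### Hamidoune connectivity `c(A) = |A·S| − K|A|` (Tao 2011, §2) -/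

/-- **Tao 2013, Lemma 3 (Submodularity).**  For `c(A) = |A·S| − K|A|`: "For any finite subsets
`A, B, S` of `G`, and any `K ∈ ℝ` one has `c(A ∪ B) + c(A ∩ B) ≤ c(A) + c(B)`."  Proof as printed
(inclusion–exclusion, `(A ∪ B)·S = A·S ∪ B·S`, `(A ∩ B)·S ⊆ A·S ∩ B·S`).
[cite: Tao2013SmallDoubling, Lemma 3] -/
theorem submodularity (S : Finset G) (K : ℝ) (c : Finset G → ℝ)
    (hc : ∀ A, c A = (#(A * S) : ℝ) - K * #A) (A B : Finset G) :
    c (A ∪ B) + c (A ∩ B) ≤ c A + c B := by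
  have h1 : #(A ∪ B) + #(A ∩ B) = #A + #B := card_union_add_card_inter A B
  have h2 : #((A ∪ B) * S) + #((A ∩ B) * S) ≤ #(A * S) + #(B * S) := by
    rw [union_mul, ← card_union_add_card_inter (A * S) (B * S)]
    exact Nat.add_le_add_left (card_le_card (inter_mul_subset)) _
  rw [hc, hc, hc, hc]
  have h1' : (#(A ∪ B) : ℝ) + #(A ∩ B) = #A + #B := by exact_mod_cast h1
  have h2' : (#((A ∪ B) * S) : ℝ) + #((A ∩ B) * S) ≤ #(A * S) + #(B * S) := by exact_mod_cast h2
  have h3 : K * (#(A ∪ B) : ℝ) + K * #(A ∩ B) = K * #A + K * #B := by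
    rw [← mul_add, ← mul_add, h1']
  linarith

/-- Left-invariance of the connectivity, Tao's eq. (3): `c(x·A) = c(A)`.
[cite: Tao2013SmallDoubling, §2 eq. (3)] -/
theorem conn_singleton_mul (S : Finset G) (K : ℝ) (c : Finset G → ℝ)
    (hc : ∀ A, c A = (#(A * S) : ℝ) - K * #A) (x : G) (A : Finset G) :
    c ({x} * A) = c A := by
  rw [hc, hc, mul_assoc, card_singleton_mul, card_singleton_mul]

/-- Tao's eq. (5): `c(A) ≥ (1 − K)|A|` (for every `K`, as `|A·S| ≥ |A|` when `S ≠ ∅`).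
[cite: Tao2013SmallDoubling, §2 eq. (5)] -/
theorem sub_mul_card_le_conn (S : Finset G) (hS : S.Nonempty) (K : ℝ) (c : Finset G → ℝ)
    (hc : ∀ A, c A = (#(A * S) : ℝ) - K * #A) (A : Finset G) :
    (1 - K) * #A ≤ c A := by
  rw [hc]
  have : (#A : ℝ) ≤ #(A * S) := by exact_mod_cast card_le_card_mul_right hS
  linarith

/-- **Existence of atoms** (Tao 2013 §2, after Hamidoune): for `K < 1` "`κ` is positive, hence
at least one fragment exists, which (by the well-ordering principle) implies that at least one atom
exists" — there is a non-empty finite `H₀` minimising `c` over all non-empty finite sets (a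
FRAGMENT) and of least cardinality among such minimisers (an ATOM).  Kernel proof: by (5) only sets
with `|B| ≤ M = ⌈(|S| − K)/(1 − K)⌉ + 1` can beat `c({1})`, and their pairs `(|B|, |B·S|)` range
over a finite set, on which `(n, m) ↦ n − Km` and then `m` are minimised.
[cite: Tao2013SmallDoubling, §2 (fragments, atoms)] -/
theorem exists_atom (S : Finset G) (hS : S.Nonempty) (K : ℝ) (hK : K < 1) (c : Finset G → ℝ)
    (hc : ∀ A, c A = (#(A * S) : ℝ) - K * #A) :
    ∃ H₀ : Finset G, H₀.Nonempty ∧ (∀ B : Finset G, B.Nonempty → c H₀ ≤ c B) ∧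
      (∀ B : Finset G, B.Nonempty → c B ≤ c H₀ → #H₀ ≤ #B) := by
  classical
  -- sizes of candidate fragments are bounded by `M`, their expansions by `N`
  set M : ℕ := ⌈((#S : ℝ) - K) / (1 - K)⌉₊ + 1 with hM
  set N : ℕ := M * #S with hN
  have hK1 : 0 < 1 - K := by linarith
  have hM1 : 1 ≤ M := by omega
  have hMge : ((#S : ℝ) - K) / (1 - K) ≤ M := by
    rw [hM]; push_cast
    exact (Nat.le_ceil _).trans (by linarith)
  have hbig : ∀ B : Finset G, M ≤ #B → c {1} ≤ c B := by
    intro B hB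
    have h1 : c {1} = #S - K := by rw [hc, singleton_mul]; simp
    have h2 := sub_mul_card_le_conn S hS K c hc B
    have h3 : ((#S : ℝ) - K) ≤ (1 - K) * M := by
      rw [div_le_iff₀ hK1] at hMge; linarith
    have h4 : (M : ℝ) ≤ #B := by exact_mod_cast hB
    nlinarith
  -- the finite set of realised pairs `(|B|, |B S|)` with `|B| ≤ M`
  set P : Finset (ℕ × ℕ) := ((range (M + 1)) ×ˢ (range (N + 1))).filter
    (fun p => ∃ B : Finset G, B.Nonempty ∧ #B = p.1 ∧ #(B * S) = p.2) with hP
  have hreal : ∀ B : Finset G, B.Nonempty → #B ≤ M → (#B, #(B * S)) ∈ P := by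
    intro B hB hBM
    rw [hP, mem_filter, mem_product, mem_range, mem_range]
    refine ⟨⟨by omega, ?_⟩, B, hB, rfl, rfl⟩
    have : #(B * S) ≤ #B * #S := card_mul_le
    have : #B * #S ≤ M * #S := Nat.mul_le_mul_right _ hBM
    omega
  have h1P : (1, #S) ∈ P := by
    have := hreal {1} (singleton_nonempty 1) (by simp; exact hM1)
    simpa [singleton_mul] using this
  have hPne : P.Nonempty := ⟨_, h1P⟩
  set f : ℕ × ℕ → ℝ := fun p => (p.2 : ℝ) - K * p.1 with hf
  have hfB : ∀ B : Finset G, f (#B, #(B * S)) = c B := fun B => by rw [hf, hc]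
  obtain ⟨p₀, hp₀, hmin₀⟩ := exists_min_image P f hPne
  set P' := P.filter (fun p => f p = f p₀) with hP'
  have hP'ne : P'.Nonempty := ⟨p₀, mem_filter.2 ⟨hp₀, rfl⟩⟩
  obtain ⟨p₁, hp₁, hmin₁⟩ := exists_min_image P' (fun p => p.1) hP'ne
  rw [hP', mem_filter] at hp₁
  obtain ⟨hp₁P, hfp₁⟩ := hp₁
  have hp₁P' := hp₁P
  rw [hP, mem_filter] at hp₁P'
  obtain ⟨-, H₀, hH₀ne, hH₀1, hH₀2⟩ := hp₁P'
  have hcH₀ : c H₀ = f p₀ := by rw [← hfB, hH₀1, hH₀2, ← hfp₁]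
  -- `H₀` is a fragment
  have hfrag : ∀ B : Finset G, B.Nonempty → c H₀ ≤ c B := by
    intro B hB
    by_cases hBM : #B ≤ M
    · rw [hcH₀, ← hfB]
      exact hmin₀ _ (hreal B hB hBM)
    · push Not at hBM
      have h1 : c H₀ ≤ c {1} := by
        rw [hcH₀, ← hfB]
        exact hmin₀ _ (hreal {1} (singleton_nonempty 1) (by simp; exact hM1))
      exact h1.trans (hbig B hBM.le)
  refine ⟨H₀, hH₀ne, hfrag, fun B hB hcB => ?_⟩
  -- `H₀` has minimal cardinality among fragments
  by_cases hBM : #B ≤ M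
  · have hBP : (#B, #(B * S)) ∈ P' := by
      rw [hP', mem_filter]
      refine ⟨hreal B hB hBM, ?_⟩
      rw [hfB, ← hcH₀]
      exact le_antisymm hcB (hfrag B hB)
    have := hmin₁ _ hBP
    rw [hH₀1]
    exact this
  · push Not at hBM
    have : p₁.1 ≤ M := by
      rw [hP, mem_filter, mem_product, mem_range] at hp₁P
      omega
    rw [hH₀1]
    omega

/-- "Let `A` and `B` be fragments with non-empty intersection … This forces
`c(A ∪ B) = c(A ∩ B) = κ`, and so `A ∪ B` and `A ∩ B` are also fragments" (Tao 2013 §2, from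
Lemma 3). [cite: Tao2013SmallDoubling, §2] -/
theorem fragment_inter_union (S : Finset G) (K : ℝ) (c : Finset G → ℝ)
    (hc : ∀ A, c A = (#(A * S) : ℝ) - K * #A) {A B : Finset G}
    (hA : ∀ B' : Finset G, B'.Nonempty → c A ≤ c B') (hB : ∀ B' : Finset G, B'.Nonempty → c B ≤ c B')
    (hAB : (A ∩ B).Nonempty) :
    c (A ∩ B) = c A ∧ c (A ∪ B) = c A := by
  have hAne : A.Nonempty := hAB.mono inter_subset_left
  have hBne : B.Nonempty := hAB.mono inter_subset_right
  have h1 := submodularity S K c hc A B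
  have h2 := hA (A ∩ B) hAB
  have h3 := hA (A ∪ B) (hAne.mono subset_union_left)
  have h4 : c B = c A := le_antisymm (hB A hAne) (hA B hBne)
  constructor <;> linarith

/-- "Any two atoms `A, B` are either equal or disjoint" (Tao 2013 §2: an atom contains no strictly
smaller fragment, and `A ∩ B` is a fragment). [cite: Tao2013SmallDoubling, §2] -/
theorem atom_eq_of_inter_nonempty (S : Finset G) (K : ℝ) (c : Finset G → ℝ)
    (hc : ∀ A, c A = (#(A * S) : ℝ) - K * #A) {A B : Finset G}
    (hA : ∀ B' : Finset G, B'.Nonempty → c A ≤ c B')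
    (hAmin : ∀ B' : Finset G, B'.Nonempty → c B' ≤ c A → #A ≤ #B')
    (hB : ∀ B' : Finset G, B'.Nonempty → c B ≤ c B')
    (hBmin : ∀ B' : Finset G, B'.Nonempty → c B' ≤ c B → #B ≤ #B')
    (hAB : (A ∩ B).Nonempty) : A = B := by
  have hi := (fragment_inter_union S K c hc hA hB hAB).1
  have hcBA : c B = c A :=
    le_antisymm (hB A (hAB.mono inter_subset_left)) (hA B (hAB.mono inter_subset_right))
  have h1 : #A ≤ #(A ∩ B) := hAmin _ hAB hi.le
  have h2 : #B ≤ #(A ∩ B) := hBmin _ hAB (by rw [hi, hcBA])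
  have e1 : A ∩ B = A := eq_of_subset_of_card_le inter_subset_left h1
  have e2 : A ∩ B = B := eq_of_subset_of_card_le inter_subset_right h2
  rw [← e1, e2]

/-- **Tao 2013, Proposition 4.**  "Let `K < 1`.  Then there exists a finite group `H`, such that
every left-coset of `H` is an atom."  Here: there is a finite set `H ∋ 1`, closed under `*` and
`⁻¹` (a finite subgroup), which is an atom — `c(H) ≤ c(B)` for every non-empty finite `B`, and
`|H| ≤ |B|` for every such `B` with `c(B) ≤ c(H)` (its left translates `x·H` are then atoms too, by
`conn_singleton_mul`).  Proof as printed: translate an atom to contain `1`; "this atom is either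
equal or disjoint to any of its left-translates, which implies that `H` is a finite group".
[cite: Tao2013SmallDoubling, Prop 4] -/
theorem exists_atom_subgroup (S : Finset G) (hS : S.Nonempty) (K : ℝ) (hK : K < 1)
    (c : Finset G → ℝ) (hc : ∀ A, c A = (#(A * S) : ℝ) - K * #A) :
    ∃ H : Finset G, (1 : G) ∈ H ∧ (∀ x ∈ H, ∀ y ∈ H, x * y ∈ H) ∧ (∀ x ∈ H, x⁻¹ ∈ H) ∧
      (∀ B : Finset G, B.Nonempty → c H ≤ c B) ∧
      (∀ B : Finset G, B.Nonempty → c B ≤ c H → #H ≤ #B) := by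
  obtain ⟨H₀, ⟨a, ha⟩, hfrag₀, hmin₀⟩ := exists_atom S hS K hK c hc
  -- translate the atom to contain `1`
  set H := ({a⁻¹} : Finset G) * H₀ with hH
  have hcH : c H = c H₀ := conn_singleton_mul S K c hc a⁻¹ H₀
  have hcardH : #H = #H₀ := card_singleton_mul a⁻¹ H₀
  have hfrag : ∀ B : Finset G, B.Nonempty → c H ≤ c B := fun B hB => hcH ▸ hfrag₀ B hB
  have hmin : ∀ B : Finset G, B.Nonempty → c B ≤ c H → #H ≤ #B :=
    fun B hB hcB => hcardH ▸ hmin₀ B hB (hcH ▸ hcB)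
  have h1H : (1 : G) ∈ H := by
    rw [hH, ← inv_mul_cancel a]
    exact mul_mem_mul (mem_singleton_self _) ha
  -- every left translate `h H`, `h ∈ H`, is an atom meeting `H`, hence equals `H`
  have hfix : ∀ h ∈ H, ({h} : Finset G) * H = H := by
    intro h hh
    have hfrag' : ∀ B : Finset G, B.Nonempty → c ({h} * H) ≤ c B :=
      fun B hB => (conn_singleton_mul S K c hc h H).symm ▸ hfrag B hB
    have hmin' : ∀ B : Finset G, B.Nonempty → c B ≤ c ({h} * H) → #({h} * H) ≤ #B :=
      fun B hB hcB => (card_singleton_mul h H).symm ▸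
        hmin B hB ((conn_singleton_mul S K c hc h H) ▸ hcB)
    exact atom_eq_of_inter_nonempty S K c hc hfrag' hmin' hfrag hmin
      ⟨h, mem_inter.2 ⟨mem_mul.2 ⟨h, mem_singleton_self _, 1, h1H, mul_one h⟩, hh⟩⟩
  refine ⟨H, h1H, fun x hx y hy => ?_, fun x hx => ?_, hfrag, hmin⟩
  · rw [← hfix x hx]
    exact mul_mem_mul (mem_singleton_self _) hy
  · have h1 : (1 : G) ∈ ({x} : Finset G) * H := by rw [hfix x hx]; exact h1H
    obtain ⟨u, hu, y, hy, hxy⟩ := mem_mul.1 h1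
    rw [mem_singleton] at hu
    subst hu
    rw [inv_eq_of_mul_eq_one_right hxy]
    exact hy

/-- Two right cosets `Hx`, `Hy` of a (finite) subgroup `H` with `y ∉ Hx` are disjoint. [folklore] -/
private theorem disjoint_rightCoset (H : Finset G) (hmul : ∀ x ∈ H, ∀ y ∈ H, x * y ∈ H)
    (hinv : ∀ x ∈ H, x⁻¹ ∈ H) {x y : G} (hxy : y ∉ H.image (· * x)) :
    Disjoint (H.image (· * x)) (H.image (· * y)) := by
  rw [disjoint_left]
  rintro z hz hz'
  obtain ⟨h, hh, rfl⟩ := mem_image.1 hz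
  obtain ⟨h', hh', he⟩ := mem_image.1 hz'
  apply hxy
  -- `h' y = h x` ⇒ `y = h'⁻¹ h x`
  refine mem_image.2 ⟨h'⁻¹ * h, hmul _ (hinv _ hh') _ hh, ?_⟩
  rw [mul_assoc, ← he, ← mul_assoc, inv_mul_cancel, one_mul]

/-- A minimal system `X ⊆ S` of representatives of the right cosets of `H` met by `S`:
`S ⊆ H·X` and `|H| |X| ≤ |H·S|` (the cosets `Hx`, `x ∈ X`, are pairwise disjoint by minimality).
[folklore] -/
private theorem exists_repr_rightCosets (H S : Finset G) (h1 : (1 : G) ∈ H)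
    (hmul : ∀ x ∈ H, ∀ y ∈ H, x * y ∈ H) (hinv : ∀ x ∈ H, x⁻¹ ∈ H) :
    ∃ X : Finset G, X ⊆ S ∧ S ⊆ H * X ∧ #H * #X ≤ #(H * S) := by
  classical
  set F := S.powerset.filter (fun X => S ⊆ H * X) with hF
  have hSF : S ∈ F := by
    rw [hF, mem_filter, mem_powerset]
    refine ⟨Subset.rfl, fun s hs => ?_⟩
    rw [← one_mul s]; exact mul_mem_mul h1 hs
  obtain ⟨X, hX, hmin⟩ := exists_min_image F card ⟨S, hSF⟩
  rw [hF, mem_filter, mem_powerset] at hX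
  obtain ⟨hXS, hSX⟩ := hX
  refine ⟨X, hXS, hSX, ?_⟩
  -- the right cosets `H x`, `x ∈ X`, are pairwise disjoint by minimality
  have hpd : (X : Set G).PairwiseDisjoint (fun x => H.image (· * x)) := by
    intro x hx y hy hne
    by_contra hnd
    have hyx : y ∈ H.image (· * x) := by
      by_contra hyx
      exact hnd (disjoint_rightCoset H hmul hinv hyx)
    -- then `X.erase y` still works
    have hF' : X.erase y ∈ F := by
      rw [hF, mem_filter, mem_powerset]
      refine ⟨(erase_subset _ _).trans hXS, fun s hs => ?_⟩
      obtain ⟨h, hh, z, hz, rfl⟩ := mem_mul.1 (hSX hs)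
      by_cases hzy : z = y
      · subst hzy
        obtain ⟨h', hh', rfl⟩ := mem_image.1 hyx
        rw [← mul_assoc]
        exact mul_mem_mul (hmul _ hh _ hh') (mem_erase.2 ⟨hne, hx⟩)
      · exact mul_mem_mul hh (mem_erase.2 ⟨hzy, hz⟩)
    have := hmin _ hF'
    rw [card_erase_of_mem hy] at this
    have := card_pos.2 ⟨y, hy⟩
    omega
  calc #H * #X = ∑ x ∈ X, #(H.image (· * x)) := by
        rw [mul_comm, sum_const_nat fun x _ => card_image_of_injective _ (mul_left_injective x)]
    _ = #(X.biUnion fun x => H.image (· * x)) := (card_biUnion hpd).symm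
    _ ≤ #(H * S) := card_le_card fun z hz => by
        rw [mem_biUnion] at hz
        obtain ⟨x, hx, hz⟩ := hz
        obtain ⟨h, hh, rfl⟩ := mem_image.1 hz
        exact mul_mem_mul hh (hXS hx)

/-- **Tao 2013, Theorem 2 (Weak Kneser-type theorem; Hamidoune–Tao).**  "Let `A, S` be finite
non-empty subsets of a multiplicative group `G = (G, ·)` such that `|A| ≥ |S|` and
`|A · S| ≤ (2 − ε)|S|` for some `ε > 0`.  Then one of the following statements hold: • `S` is
contained in a right-coset of a finite group `H` with `|H| ≤ (2/ε)|S|`; • `S` is covered by at most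
`2/ε − 1` right cosets of a finite group `H` with `|H| ≤ |S|`."  Here `H` is a finite subset
containing `1` and closed under `*`, `⁻¹`; "covered by at most `2/ε − 1` right cosets" is
`∃ X ⊆ S, |X| ≤ 2/ε − 1, S ⊆ H·X`.  Proof as printed (§3), `H` = the atom of Proposition 4 for
`K = 1 − ε/2`. [cite: Tao2013SmallDoubling, Thm 2] -/
theorem weak_kneser (A S : Finset G) (hS : S.Nonempty) (hAS : #S ≤ #A) {ε : ℝ} (hε : 0 < ε)
    (h : (#(A * S) : ℝ) ≤ (2 - ε) * #S) :
    ∃ H : Finset G, (1 : G) ∈ H ∧ (∀ x ∈ H, ∀ y ∈ H, x * y ∈ H) ∧ (∀ x ∈ H, x⁻¹ ∈ H) ∧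
      (((∃ x : G, S ⊆ H.image (· * x)) ∧ (#H : ℝ) ≤ 2 / ε * #S) ∨
       ((∃ X : Finset G, X ⊆ S ∧ (#X : ℝ) ≤ 2 / ε - 1 ∧ S ⊆ H * X) ∧ #H ≤ #S)) := by
  classical
  have hSpos : (0 : ℝ) < #S := by exact_mod_cast hS.card_pos
  have hAS' : (#S : ℝ) ≤ #A := by exact_mod_cast hAS
  have hASge : (#A : ℝ) ≤ #(A * S) := by exact_mod_cast card_le_card_mul_right hS
  -- `ε ≤ 1`, so `K = 1 - ε/2 ∈ [1/2, 1)`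
  have hε1 : ε ≤ 1 := by nlinarith
  set K : ℝ := 1 - ε / 2 with hK
  have hK1 : K < 1 := by rw [hK]; linarith
  have hK0 : 0 ≤ K := by rw [hK]; linarith
  set c : Finset G → ℝ := fun B => (#(B * S) : ℝ) - K * #B with hcdef
  have hc : ∀ B, c B = (#(B * S) : ℝ) - K * #B := fun B => rfl
  obtain ⟨H, h1, hmul, hinv, hfrag, -⟩ := exists_atom_subgroup S hS K hK1 c hc
  have hHne : H.Nonempty := ⟨1, h1⟩
  have hHpos : (0 : ℝ) < #H := by exact_mod_cast hHne.card_pos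
  -- `c(H) ≤ c(A) ≤ (1 - ε/2)|S|` and `c(H) ≥ (ε/2)|H|`
  have hcA : c A ≤ (1 - ε / 2) * #S := by
    rw [hc]; nlinarith
  have hcH := hfrag A (card_pos.1 (lt_of_lt_of_le hS.card_pos hAS))
  have hcHlb := sub_mul_card_le_conn S hS K c hc H
  have hH1 : ε / 2 * #H ≤ (1 - ε / 2) * #S := by rw [hK] at hcHlb; linarith
  refine ⟨H, h1, hmul, hinv, ?_⟩
  by_cases hone : ∃ x : G, S ⊆ H.image (· * x)
  · left
    refine ⟨hone, ?_⟩
    rw [div_mul_eq_mul_div, le_div_iff₀ hε]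
    nlinarith
  · right
    -- `S` meets two right cosets of `H`, so `|H S| ≥ 2|H|`
    obtain ⟨s₁, hs₁⟩ := hS
    have : ¬ S ⊆ H.image (· * s₁) := fun hsub => hone ⟨s₁, hsub⟩
    obtain ⟨s₂, hs₂, hs₂'⟩ := not_subset.1 this
    have hHS2 : 2 * #H ≤ #(H * S) := by
      have hd := disjoint_rightCoset H hmul hinv hs₂'
      have := card_le_card (show H.image (· * s₁) ∪ H.image (· * s₂) ⊆ H * S from
        union_subset (fun z hz => by obtain ⟨h, hh, rfl⟩ := mem_image.1 hz; exact mul_mem_mul hh hs₁)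
          (fun z hz => by obtain ⟨h, hh, rfl⟩ := mem_image.1 hz; exact mul_mem_mul hh hs₂))
      rw [card_union_of_disjoint hd, card_image_of_injective _ (mul_left_injective _),
        card_image_of_injective _ (mul_left_injective _)] at this
      omega
    have hHS2' : 2 * (#H : ℝ) ≤ #(H * S) := by exact_mod_cast hHS2
    -- (hs): `|H S| ≤ (1 - ε/2)(|S| + |H|)`
    have hs : (#(H * S) : ℝ) ≤ (1 - ε / 2) * #S + (1 - ε / 2) * #H := by
      have := hcH.trans hcA
      rw [hc, hK] at this
      linarith
    have hSHS : (#S : ℝ) ≤ #(H * S) := by exact_mod_cast card_le_card_mul_left hHne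
    constructor
    · obtain ⟨X, hXS, hSX, hX⟩ := exists_repr_rightCosets H S h1 hmul hinv
      refine ⟨X, hXS, ?_, hSX⟩
      have hX' : (#H : ℝ) * #X ≤ #(H * S) := by exact_mod_cast hX
      have h2 : ε / 2 * #(H * S) ≤ (1 - ε / 2) * #H := by nlinarith
      have h3 : (#H : ℝ) * (ε / 2 * #X) ≤ #H * (1 - ε / 2) := by nlinarith
      have h4 := le_of_mul_le_mul_left h3 hHpos
      rw [show 2 / ε - 1 = (1 - ε / 2) / (ε / 2) by field_simp]
      rw [le_div_iff₀ (by linarith)]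
      linarith
    · have : (#H : ℝ) ≤ #S := by nlinarith
      exact_mod_cast this

/-- **Tao 2013, Theorem 2**, with `H` bundled as a `Subgroup G` (finite, `Nat.card H` for `|H|`).
[cite: Tao2013SmallDoubling, Thm 2] -/
theorem weak_kneser_subgroup (A S : Finset G) (hS : S.Nonempty) (hAS : #S ≤ #A) {ε : ℝ}
    (hε : 0 < ε) (h : (#(A * S) : ℝ) ≤ (2 - ε) * #S) :
    ∃ H : Subgroup G, (H : Set G).Finite ∧
      (((∃ x : G, (S : Set G) ⊆ (fun h => h * x) '' (H : Set G)) ∧ (Nat.card H : ℝ) ≤ 2 / ε * #S) ∨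
       ((∃ X : Finset G, X ⊆ S ∧ (#X : ℝ) ≤ 2 / ε - 1 ∧ (S : Set G) ⊆ (H : Set G) * (X : Set G)) ∧
          Nat.card H ≤ #S)) := by
  obtain ⟨H, h1, hmul, hinv, halt⟩ := weak_kneser A S hS hAS hε h
  let K : Subgroup G :=
    { carrier := ↑H
      mul_mem' := fun {x y} hx hy => by
        rw [mem_coe] at hx hy ⊢; exact hmul x hx y hy
      one_mem' := by rw [mem_coe]; exact h1
      inv_mem' := fun {x} hx => by rw [mem_coe] at hx ⊢; exact hinv x hx }
  have hKH : (K : Set G) = ↑H := rfl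
  have hKcard : Nat.card K = #H := by
    rw [← SetLike.coe_sort_coe, hKH, Nat.card_coe_set_eq, Set.ncard_coe_finset]
  refine ⟨K, by rw [hKH]; exact H.finite_toSet, ?_⟩
  rcases halt with ⟨⟨x, hx⟩, hcard⟩ | ⟨⟨X, hXS, hXcard, hSX⟩, hcard⟩
  · left
    refine ⟨⟨x, fun s hs => ?_⟩, by rw [hKcard]; exact hcard⟩
    have := hx (mem_coe.1 hs)
    obtain ⟨h', hh', rfl⟩ := mem_image.1 this
    exact ⟨h', by rw [hKH]; exact mem_coe.2 hh', rfl⟩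
  · right
    refine ⟨⟨X, hXS, hXcard, fun s hs => ?_⟩, by rw [hKcard]; exact hcard⟩
    have := hSX (mem_coe.1 hs)
    rw [hKH, ← coe_mul]
    exact mem_coe.2 this

end HamidouneTao

section Abelian

variable {α : Type*} [CommGroup α] [DecidableEq α]

/-- **Tao 2013, Corollary 1 (of Kneser's theorem; commutative groups).**  "Let `A` be a finite
non-empty subset of an additive group `G` such that `|A + A| ≤ (2 − ε)|A|` for some `ε > 0`.  Then
there exists a finite group `H` with `|H| ≤ (2 − ε)|A|`, such that `A + A` is covered by at most
`2/ε − 1` translates of `H`."  Multiplicative notation, `H = (A·A).mulStab` (the tree's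
`Finset.mulStab`, `Kneser.lean`): `ε|A| ≤ |H| ≤ (2 − ε)|A|` and `A·A = X·H` with `X ⊆ A·A`,
`|X| ≤ 2/ε − 1`.  Proof as printed: Kneser (`card_add_card_le_card_mul_add_card_mulStab`) gives
`|H| ≥ ε|A|`, and `A·A` is `H`-invariant. [cite: Tao2013SmallDoubling, Cor 1] -/
theorem kneser_small_doubling (A : Finset α) (hA : A.Nonempty) {ε : ℝ} (hε : 0 < ε)
    (h : (#(A * A) : ℝ) ≤ (2 - ε) * #A) :
    ε * #A ≤ #(A * A).mulStab ∧ (#(A * A).mulStab : ℝ) ≤ (2 - ε) * #A ∧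
      ∃ X : Finset α, X ⊆ A * A ∧ (#X : ℝ) ≤ 2 / ε - 1 ∧ A * A = X * (A * A).mulStab := by
  set H := (A * A).mulStab with hH
  have hAA : (A * A).Nonempty := hA.mul hA
  have hK := card_add_card_le_card_mul_add_card_mulStab A A hA hA
  have hK' : (#A : ℝ) + #A ≤ #(A * A) + #H := by rw [hH]; exact_mod_cast hK
  have h1 : ε * #A ≤ #H := by linarith
  have h2 : (#H : ℝ) ≤ (2 - ε) * #A :=
    le_trans (by rw [hH]; exact_mod_cast Finset.card_mulStab_le_card) h
  refine ⟨h1, h2, ?_⟩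
  -- `H` is a subgroup (as a finset)
  have hH1 : (1 : α) ∈ H := (Finset.one_mem_mulStab).2 hAA
  have hHmul : ∀ x ∈ H, ∀ y ∈ H, x * y ∈ H := fun x hx y hy => by
    rw [hH, ← Finset.mulStab_mul_mulStab (A * A)]
    exact mul_mem_mul hx hy
  have hHinv : ∀ x ∈ H, x⁻¹ ∈ H := fun x hx => by
    have hx' : x ∈ (H : Set α) := mem_coe.2 hx
    rw [hH, Finset.coe_mulStab hAA] at hx'
    have := Subgroup.inv_mem _ hx'
    rw [← mem_coe, hH, Finset.coe_mulStab hAA]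
    exact this
  obtain ⟨X, hXS, hSX, hcard⟩ := HamidouneTao.exists_repr_rightCosets H (A * A) hH1 hHmul hHinv
  have hHAA : H * (A * A) = A * A := by rw [hH]; exact Finset.mulStab_mul (A * A)
  rw [hHAA] at hcard
  have hApos : (0 : ℝ) < #A := by exact_mod_cast hA.card_pos
  have hHpos : (0 : ℝ) < #H := lt_of_lt_of_le (by positivity) h1
  refine ⟨X, hXS, ?_, ?_⟩
  · have hcard' : (#H : ℝ) * #X ≤ #(A * A) := by exact_mod_cast hcard
    -- `ε |A| |X| ≤ |H| |X| ≤ |A A| ≤ (2 - ε)|A|`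
    have h3 : ε * #A * #X ≤ (2 - ε) * #A := by nlinarith
    have h4 : ε * #X ≤ 2 - ε := by
      have h3' : (#A : ℝ) * (ε * #X) ≤ #A * (2 - ε) := by nlinarith
      exact le_of_mul_le_mul_left h3' hApos
    rw [show 2 / ε - 1 = (2 - ε) / ε by field_simp, le_div_iff₀ hε]
    linarith
  · apply Subset.antisymm
    · rw [mul_comm X H]; exact hSX
    · calc X * H ⊆ (A * A) * H := mul_subset_mul_right hXS
        _ = A * A := by rw [hH]; exact Finset.mul_mulStab (A * A)

end Abelian

end Literature.Combinatorics.Additive
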